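import Literature.AlgebraicGeometry.Frobenioids.CoAngular
import Literature.AlgebraicGeometry.Frobenioids.CategoriesFactorization
import HarnessLib

/-!
# Frobenioids I, Proposition 1.7: composites of morphisms in a Frobenioid
# (STEP-0 calibration fragment of the abc-iut cell — axiomatic-proof genre, second sample)

Mochizuki, *The geometry of Frobenioids I: the general theory*, Kyushu J. Math. **62** (2008)
293–400, §1, Proposition 1.7 "(Composites of Morphisms)" and its proof, kurims text pp. 28–30
[cite: MochizukiFrdI2008, Prop. 1.7]:

> "Let `Φ` be a divisorial monoid on a connected, totally epimorphic category `D`; `C → F_Φ` a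
> Frobenioid. Then: (i) The following classes of morphisms are closed under composition:
> isometries, base-isomorphisms, base-FSM-morphisms, pull-back morphisms, linear morphisms,
> pre-steps, co-angular morphisms, LB-invertible morphisms, morphisms of Frobenius type.
> (ii) A morphism of `C` is a pull-back morphism if and only if it is minimal-adjoint to the
> base-isomorphisms of `C`. A morphism of `C` is a base-isomorphism if and only if it is
> minimal-coadjoint to the pull-back morphisms of `C`; alternatively, a morphism of `C` is a
> base-isomorphism if and only if it may be written as a composite `α ∘ β`, where `α` is a
> pre-step, and `β` is a morphism of Frobenius type. (iii) A morphism of `C` is of Frobenius type if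
> and only if it is minimal-coadjoint to the linear morphisms of `C`. A morphism of `C` is linear if
> and only if it is minimal-adjoint to the morphisms of Frobenius type of `C`; alternatively, a
> morphism of `C` is linear if and only if it may be written as a composite `α ∘ β`, where `α` is
> a pull-back morphism, and `β` is a pre-step. (iv) A pre-step of `C` is co-angular if and only if
> it is mid-adjoint [cf. §0] to the isometric pre-steps. (v) If a composite morphism `φ = α ∘ β` of
> `C` is a(n) isomorphism (respectively, base-isomorphism; linear morphism; pre-step; isometry;
> co-angular pre-step; co-angular linear morphism; pull-back morphism), then so are `α`, `β`. If,
> moreover, the domain of `φ` is isotropic, then a similar statement holds for morphisms of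
> Frobenius type."

The Lean proof follows the printed one (p. 29 l. 16 – p. 30 l. 9): (i) from the definitions and
Def. 1.3 (iii)(a); sufficiency in (ii), (iii) from the existence of the factorisation of Def. 1.3
(iv)(a); necessity for pull-back morphisms from its essential uniqueness and total epimorphicity
of `C`, for base-isomorphisms from total epimorphicity of `D`, for linear morphisms from `N_{≥1}`
and Prop. 1.4 (iii), for morphisms of Frobenius type from their co-angularity (the text cites the
essential uniqueness of the factorisation; the shorter route is recorded in the docstring of
`isFrobeniusType_iff_isMinimalCoadjoint`); (iv) from (v) for pre-steps; (v) as printed, the case of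
co-angular linear morphisms via the decomposition "linear = (co-angular linear) ∘ (isometric
pre-step)". Arrows are composed in diagrammatic order: `β ≫ α` is the text's `α ∘ β`, and
"so are `α`, `β`" is rendered as a conjunction (second arrow first). The classes "morphisms of
Frobenius type" and "isometric pre-steps", which have no name in `PreFrobenioidMorphisms.lean`,
are written as anonymous `MorphismProperty`s. No statement of the paper is strengthened.
-/

namespace Literature.AlgebraicGeometry.Frobenioids

open CategoryTheory Opposite

universe w v v' u u'

/-- In `N_{≥1}`, `m n = 1` forces `m = 1` and `n = 1`. [folklore] -/
private theorem pnat_eq_one_and_eq_one_of_mul_eq_one {m n : ℕ+} (h : m * n = 1) : m = 1 ∧ n = 1 := by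
  have h' : (m : ℕ) * n = 1 := by rw [← PNat.mul_coe, h, PNat.one_coe]
  exact ⟨PNat.eq (by rw [PNat.one_coe]; exact Nat.eq_one_of_mul_eq_one_right h'),
    PNat.eq (by rw [PNat.one_coe]; exact Nat.eq_one_of_mul_eq_one_left h')⟩

namespace PreFrobenioid

variable {D : Type u} [Category.{v} D] {Φ : Dᵒᵖ ⥤ CommMonCat.{w}}
  {C : Type u'} [Category.{v'} C] (F : C ⥤ ElemFrobenioid Φ)

/-! ### Proposition 1.7 (v), the elementary cases ("In light of Remark 1.1.1 …") -/

/-- **Prop. 1.7 (v)**, base-isomorphisms: if `α ∘ β` is a base-isomorphism then so are `α`, `β`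
("from the fact that `D` is totally epimorphic"). [cite: MochizukiFrdI2008, Prop. 1.7] -/
theorem isBaseIso_factors (hD : IsTotallyEpimorphic D) {X Y Z : C} {β : X ⟶ Y} {α : Y ⟶ Z}
    (h : IsBaseIso F (β ≫ α)) : IsBaseIso F α ∧ IsBaseIso F β := by
  haveI : IsIso (Base F β ≫ Base F α) := by
    rw [← base_comp]
    exact h
  exact hD.isIso_of_isIso_comp (Base F β) (Base F α)

/-- **Prop. 1.7 (v)**, linear morphisms: if `α ∘ β` is linear then so are `α`, `β` ("from the
well-known structure of the multiplicative monoid `N_{≥1}`"). [cite: MochizukiFrdI2008, Prop. 1.7] -/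
theorem isLinear_factors {X Y Z : C} {β : X ⟶ Y} {α : Y ⟶ Z} (h : IsLinear F (β ≫ α)) :
    IsLinear F α ∧ IsLinear F β := by
  have h' : degFr F β * degFr F α = 1 := by
    rw [← degFr_comp]
    exact h
  exact ⟨(pnat_eq_one_and_eq_one_of_mul_eq_one h').2, (pnat_eq_one_and_eq_one_of_mul_eq_one h').1⟩

/-- **Prop. 1.7 (v)**, pre-steps: if `α ∘ β` is a pre-step then so are `α`, `β`.
[cite: MochizukiFrdI2008, Prop. 1.7] -/
theorem isPreStep_factors (hD : IsTotallyEpimorphic D) {X Y Z : C} {β : X ⟶ Y} {α : Y ⟶ Z}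
    (h : IsPreStep F (β ≫ α)) : IsPreStep F α ∧ IsPreStep F β :=
  ⟨⟨(isLinear_factors F h.1).1, (isBaseIso_factors F hD h.2).1⟩,
    ⟨(isLinear_factors F h.1).2, (isBaseIso_factors F hD h.2).2⟩⟩

/-- **Prop. 1.7 (v)**, isometries: if `α ∘ β` is an isometry then so are `α`, `β` ("from the fact
that the monoid `Φ` on `D` is sharp, together with the characteristic injectivity assumption of
Definition 1.1, (ii), (a)"). [cite: MochizukiFrdI2008, Prop. 1.7] -/
theorem isIsometry_factors (hP : IsPreFrobenioid Φ F) {X Y Z : C} {β : X ⟶ Y} {α : Y ⟶ Z}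
    (h : IsIsometry F (β ≫ α)) : IsIsometry F α ∧ IsIsometry F β := by
  have h' : pull Φ (Base F β) (Div F α) * Div F β ^ (degFr F α : ℕ) = 1 := by
    rw [← div_comp]
    exact h
  have hX : IsSharp (Φ.obj (op (baseObj F X))) := (hP.isDivisorial (baseObj F X)).isSharp
  have h₁ : pull Φ (Base F β) (Div F α) = 1 := hX.eq_one_of_isUnit _ (IsUnit.of_mul_eq_one _ h')
  have h₂ : Div F β ^ (degFr F α : ℕ) = 1 := hX.eq_one_of_isUnit _ (IsUnit.of_mul_eq_one_right _ h')
  refine ⟨?_, ?_⟩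
  · apply (hP.isMonoidOn.isCharInjective (Base F β)).1
    show pull Φ (Base F β) (Div F α) = pull Φ (Base F β) 1
    rw [h₁, map_one]
  · exact hX.eq_one_of_isUnit _ ((isUnit_pow_iff (degFr F α).ne_zero).mp (by
      rw [h₂]
      exact isUnit_one))

/-! ### Proposition 1.7 (i): closure under composition -/

/-- **Prop. 1.7 (i)**, base-FSM-morphisms (isometries, base-isomorphisms, linear morphisms,
pre-steps and pull-back morphisms are `IsIsometry.comp`, `IsBaseIso.comp`, `IsLinear.comp`,
`IsPreStep.comp`, `IsPullbackMorphism.comp`). [cite: MochizukiFrdI2008, Prop. 1.7] -/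
theorem IsBaseFSM.comp {X Y Z : C} {f : X ⟶ Y} {g : Y ⟶ Z} (hf : IsBaseFSM F f) (hg : IsBaseFSM F g) :
    IsBaseFSM F (f ≫ g) := by
  show IsFSM (Base F (f ≫ g))
  rw [base_comp]
  exact IsFSM.comp hf hg

/-- **Prop. 1.7 (i)**, co-angular morphisms: this is Def. 1.3 (iii)(a). [cite: MochizukiFrdI2008, Prop. 1.7] -/
theorem IsCoAngular.comp (hF : IsFrobenioid F) {X Y Z : C} {f : X ⟶ Y} {g : Y ⟶ Z}
    (hf : IsCoAngular F f) (hg : IsCoAngular F g) : IsCoAngular F (f ≫ g) :=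
  hF.iii_a f g hf hg

/-- **Prop. 1.7 (i)**, LB-invertible morphisms. [cite: MochizukiFrdI2008, Prop. 1.7] -/
theorem IsLBInvertible.comp (hF : IsFrobenioid F) {X Y Z : C} {f : X ⟶ Y} {g : Y ⟶ Z}
    (hf : IsLBInvertible F f) (hg : IsLBInvertible F g) : IsLBInvertible F (f ≫ g) :=
  ⟨hF.iii_a f g hf.1 hg.1, IsIsometry.comp F hf.2 hg.2⟩

/-- **Prop. 1.7 (i)**, morphisms of Frobenius type. [cite: MochizukiFrdI2008, Prop. 1.7] -/
theorem IsFrobeniusType.comp (hF : IsFrobenioid F) {X Y Z : C} {f : X ⟶ Y} {g : Y ⟶ Z}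
    (hf : IsFrobeniusType F f) (hg : IsFrobeniusType F g) : IsFrobeniusType F (f ≫ g) :=
  ⟨IsLBInvertible.comp F hF hf.1 hg.1, IsBaseIso.comp F hf.2 hg.2⟩

/-! ### Proposition 1.7 (ii) -/

/-- **Prop. 1.7 (ii)**: pull-back morphism ⟺ minimal-adjoint to the base-isomorphisms
(necessity via the essential uniqueness of the factorisation of Def. 1.3 (iv)(a) and total
epimorphicity of `C`). [cite: MochizukiFrdI2008, Prop. 1.7] -/
theorem isPullbackMorphism_iff_isMinimalAdjoint (hF : IsFrobenioid F) {A B : C} (φ : A ⟶ B) :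
    IsPullbackMorphism F φ ↔ IsMinimalAdjoint (baseIsomorphisms F) φ := by
  have hP : IsPreFrobenioid Φ F := hF.isPreFrobenioid
  constructor
  · intro hφ X β α hfac hβ
    subst hfac
    obtain ⟨_, hφlin⟩ := hF.iv_b _ hφ
    obtain ⟨hαlin, hβlin⟩ := isLinear_factors F hφlin
    -- factor `α`; its Frobenius-type part is linear, hence an isomorphism (Prop. 1.4 (iii))
    obtain ⟨X₂, Y₂, γ₂, β₂, α₂, hfac₂, hγ₂, hβ₂, hα₂⟩ := hF.iv_a_exists α
    obtain ⟨_, hα₂lin⟩ := hF.iv_b α₂ hα₂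
    have hdeg : degFr F γ₂ * (degFr F β₂ * degFr F α₂) = degFr F α := by
      rw [← degFr_comp, ← degFr_comp, hfac₂]
    rw [show degFr F β₂ = 1 from hβ₂.1, show degFr F α₂ = 1 from hα₂lin,
      show degFr F α = 1 from hαlin, mul_one, mul_one] at hdeg
    haveI : IsIso γ₂ := isIso_of_isLBInvertible_of_isPreStep F hF γ₂ hγ₂.1 ⟨hdeg, hγ₂.2⟩
    -- two factorisations of `β ≫ α` as in Def. 1.3 (iv)(a)
    have hpre : IsPreStep F (β ≫ γ₂ ≫ β₂) :=
      IsPreStep.comp F ⟨hβlin, hβ⟩ (IsPreStep.comp F (isPreStep_of_isIso F γ₂) hβ₂)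
    have hid : IsFrobeniusType F (𝟙 A) := isFrobeniusType_of_isIso F hP (𝟙 A)
    obtain ⟨ε, δ, _, h₂, _⟩ := hF.iv_a_unique (β ≫ α) (𝟙 A) (𝟙 A) (β ≫ α) (𝟙 A)
      (β ≫ γ₂ ≫ β₂) α₂ (by rw [Category.id_comp, Category.id_comp]) hid
      (isPreStep_of_isIso F (𝟙 A)) hφ
      (by rw [Category.id_comp, Category.assoc, Category.assoc, hfac₂]) hid hpre hα₂
    have e : β ≫ γ₂ ≫ β₂ = ε.inv ≫ 𝟙 A ≫ δ.hom := (Iso.eq_inv_comp ε).mpr h₂.symm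
    haveI : IsIso (β ≫ γ₂ ≫ β₂) := by
      rw [e]
      infer_instance
    exact (hP.isTotallyEpimorphic.isIso_of_isIso_comp β (γ₂ ≫ β₂)).2
  · intro h
    obtain ⟨X, Y, γ, β, α, hfac, hγ, hβ, hα⟩ := hF.iv_a_exists φ
    haveI : IsIso (γ ≫ β) :=
      h (γ ≫ β) α (by rw [Category.assoc, hfac]) (IsBaseIso.comp F hγ.2 hβ.2)
    rw [← hfac, ← Category.assoc]
    exact IsPullbackMorphism.comp F (isPullbackMorphism_of_isIso F (γ ≫ β)) hα

/-- **Prop. 1.7 (ii)**: base-isomorphism ⟺ minimal-coadjoint to the pull-back morphisms.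
[cite: MochizukiFrdI2008, Prop. 1.7] -/
theorem isBaseIso_iff_isMinimalCoadjoint (hF : IsFrobenioid F) {A B : C} (φ : A ⟶ B) :
    IsBaseIso F φ ↔ IsMinimalCoadjoint (pullbackMorphisms F) φ := by
  have hD : IsTotallyEpimorphic D := hF.isPreFrobenioid.isTotallyEpimorphic_base
  constructor
  · intro hφ X α β hfac hβ
    subst hfac
    exact (isPullbackMorphism_and_isBaseIso_iff_isIso F β).mp ⟨hβ, (isBaseIso_factors F hD hφ).1⟩
  · intro h
    obtain ⟨X, Y, γ, β, α, hfac, hγ, hβ, hα⟩ := hF.iv_a_exists φ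
    haveI : IsIso α := h (γ ≫ β) α (by rw [Category.assoc, hfac]) hα
    rw [← hfac, ← Category.assoc]
    exact IsBaseIso.comp F (IsBaseIso.comp F hγ.2 hβ.2) (isBaseIso_of_isIso F α)

/-- **Prop. 1.7 (ii)**, "alternatively": base-isomorphism ⟺ (pre-step) ∘ (Frobenius type).
[cite: MochizukiFrdI2008, Prop. 1.7] -/
theorem isBaseIso_iff_exists_frobeniusType_preStep (hF : IsFrobenioid F) {A B : C} (φ : A ⟶ B) :
    IsBaseIso F φ ↔
      ∃ (X : C) (β : A ⟶ X) (α : X ⟶ B), β ≫ α = φ ∧ IsFrobeniusType F β ∧ IsPreStep F α := by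
  have hD : IsTotallyEpimorphic D := hF.isPreFrobenioid.isTotallyEpimorphic_base
  constructor
  · intro hφ
    obtain ⟨X, Y, γ, β, α, hfac, hγ, hβ, hα⟩ := hF.iv_a_exists φ
    subst hfac
    obtain ⟨hβα, _⟩ := isBaseIso_factors F hD hφ
    obtain ⟨hαb, _⟩ := isBaseIso_factors F hD hβα
    haveI : IsIso α := (isPullbackMorphism_and_isBaseIso_iff_isIso F α).mp ⟨hα, hαb⟩
    exact ⟨X, γ, β ≫ α, rfl, hγ, IsPreStep.comp F hβ (isPreStep_of_isIso F α)⟩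
  · rintro ⟨X, β, α, hfac, hβ, hα⟩
    subst hfac
    exact IsBaseIso.comp F hβ.2 hα.2

/-! ### Proposition 1.7 (iii) -/

/-- **Prop. 1.7 (iii)**: Frobenius type ⟺ minimal-coadjoint to the linear morphisms (necessity:
if `φ = β ∘ α` with `β` linear, Remark 1.1.1 + sharpness + characteristic injectivity make `β` an
isometry and total epimorphicity of `D` a base-isomorphism, so the co-angularity of `φ` applied to
`φ = id ∘ β ∘ α` makes `β` an isomorphism). [cite: MochizukiFrdI2008, Prop. 1.7] -/
theorem isFrobeniusType_iff_isMinimalCoadjoint (hF : IsFrobenioid F) {A B : C} (φ : A ⟶ B) :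
    IsFrobeniusType F φ ↔ IsMinimalCoadjoint (linearMorphisms F) φ := by
  have hP : IsPreFrobenioid Φ F := hF.isPreFrobenioid
  constructor
  · intro hφ X α β hfac hβlin
    subst hfac
    obtain ⟨hβiso, _⟩ := isIsometry_factors F hP hφ.1.2
    obtain ⟨hβb, _⟩ := isBaseIso_factors F hP.isTotallyEpimorphic_base hφ.2
    exact hφ.1.1 α β (𝟙 B) (by rw [Category.comp_id]) (isLinear_of_isIso F (𝟙 B)) hβiso
      ⟨hβlin, hβb⟩ (Or.inl (isBaseIso_of_isIso F (𝟙 B)))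
  · intro h
    obtain ⟨X, Y, γ, β, α, hfac, hγ, hβ, hα⟩ := hF.iv_a_exists φ
    obtain ⟨_, hαlin⟩ := hF.iv_b α hα
    haveI : IsIso (β ≫ α) := h γ (β ≫ α) hfac (IsLinear.comp F hβ.1 hαlin)
    rw [← hfac]
    exact IsFrobeniusType.comp F hF hγ (isFrobeniusType_of_isIso F hP (β ≫ α))

/-- **Prop. 1.7 (iii)**: linear ⟺ minimal-adjoint to the morphisms of Frobenius type (necessity
via `N_{≥1}` and Prop. 1.4 (iii)). [cite: MochizukiFrdI2008, Prop. 1.7] -/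
theorem isLinear_iff_isMinimalAdjoint (hF : IsFrobenioid F) {A B : C} (φ : A ⟶ B) :
    IsLinear F φ ↔ IsMinimalAdjoint (fun _ _ f => IsFrobeniusType F f) φ := by
  constructor
  · intro hφ X β α hfac hβ
    subst hfac
    exact isIso_of_isLBInvertible_of_isPreStep F hF β hβ.1 ⟨(isLinear_factors F hφ).2, hβ.2⟩
  · intro h
    obtain ⟨X, Y, γ, β, α, hfac, hγ, hβ, hα⟩ := hF.iv_a_exists φ
    obtain ⟨_, hαlin⟩ := hF.iv_b α hα
    haveI : IsIso γ := h γ (β ≫ α) hfac hγ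
    rw [← hfac]
    exact IsLinear.comp F (isLinear_of_isIso F γ) (IsLinear.comp F hβ.1 hαlin)

/-- **Prop. 1.7 (iii)**, "alternatively": linear ⟺ (pull-back morphism) ∘ (pre-step).
[cite: MochizukiFrdI2008, Prop. 1.7] -/
theorem isLinear_iff_exists_preStep_pullback (hF : IsFrobenioid F) {A B : C} (φ : A ⟶ B) :
    IsLinear F φ ↔
      ∃ (X : C) (β : A ⟶ X) (α : X ⟶ B), β ≫ α = φ ∧ IsPreStep F β ∧ IsPullbackMorphism F α := by
  constructor
  · intro hφ
    obtain ⟨X, Y, γ, β, α, hfac, hγ, hβ, hα⟩ := hF.iv_a_exists φ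
    subst hfac
    obtain ⟨_, hγlin⟩ := isLinear_factors F hφ
    haveI : IsIso γ := isIso_of_isLBInvertible_of_isPreStep F hF γ hγ.1 ⟨hγlin, hγ.2⟩
    exact ⟨Y, γ ≫ β, α, by rw [Category.assoc], IsPreStep.comp F (isPreStep_of_isIso F γ) hβ, hα⟩
  · rintro ⟨X, β, α, hfac, hβ, hα⟩
    subst hfac
    exact IsLinear.comp F hβ.1 (hF.iv_b α hα).2

/-! ### Proposition 1.7 (iv) -/

/-- **Prop. 1.7 (iv)**: a pre-step is co-angular iff it is mid-adjoint to the isometric pre-steps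
("follows formally from the definitions and assertion (v) for pre-steps").
[cite: MochizukiFrdI2008, Prop. 1.7] -/
theorem isCoAngular_iff_isMidAdjoint_of_isPreStep (hF : IsFrobenioid F) {A B : C} (φ : A ⟶ B)
    (hφ : IsPreStep F φ) :
    IsCoAngular F φ ↔ IsMidAdjoint (fun _ _ f => IsIsometry F f ∧ IsPreStep F f) φ := by
  have hD : IsTotallyEpimorphic D := hF.isPreFrobenioid.isTotallyEpimorphic_base
  constructor
  · intro hco X Y γ β α hfac hβ
    subst hfac
    obtain ⟨hβα, hγ⟩ := isPreStep_factors F hD hφ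
    obtain ⟨hα, _⟩ := isPreStep_factors F hD hβα
    exact hco γ β α rfl hα.1 hβ.1 hβ.2 (Or.inr hγ.2)
  · intro h X Y γ β α hfac _ hβiso hβpre _
    exact h γ β α hfac ⟨hβiso, hβpre⟩

/-! ### Proposition 1.7 (v), the remaining cases -/

/-- **Prop. 1.7 (v)**, co-angular pre-steps ("from assertion (v) for pre-steps and assertion
(iv)"). [cite: MochizukiFrdI2008, Prop. 1.7] -/
theorem isCoAngularPreStep_factors (hF : IsFrobenioid F) {X Y Z : C} {β : X ⟶ Y} {α : Y ⟶ Z}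
    (h : IsCoAngularPreStep F (β ≫ α)) : IsCoAngularPreStep F α ∧ IsCoAngularPreStep F β := by
  have hD : IsTotallyEpimorphic D := hF.isPreFrobenioid.isTotallyEpimorphic_base
  obtain ⟨hα, hβ⟩ := isPreStep_factors F hD h.2
  have hmid := (isCoAngular_iff_isMidAdjoint_of_isPreStep F hF _ h.2).mp h.1
  refine ⟨⟨(isCoAngular_iff_isMidAdjoint_of_isPreStep F hF α hα).mpr ?_, hα⟩,
    ⟨(isCoAngular_iff_isMidAdjoint_of_isPreStep F hF β hβ).mpr ?_, hβ⟩⟩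
  · intro X' Y' γ' β' α' hfac hβ'
    exact hmid (β ≫ γ') β' α' (by rw [← hfac]; simp only [Category.assoc]) hβ'
  · intro X' Y' γ' β' α' hfac hβ'
    exact hmid γ' β' (α' ≫ α) (by rw [← hfac]; simp only [Category.assoc]) hβ'

/-- Every linear morphism of a Frobenioid is `κ ∘ ι` with `ι` an isometric pre-step and `κ`
co-angular linear (the factorisation (iii) for linear morphisms followed by Def. 1.3 (v)(c);
used in the proof of Prop. 1.7 (v)). [cite: MochizukiFrdI2008, Prop. 1.7] -/
theorem exists_isometricPreStep_coAngularLinear (hF : IsFrobenioid F) {A B : C} (φ : A ⟶ B)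
    (hφ : IsLinear F φ) :
    ∃ (X : C) (ι : A ⟶ X) (κ : X ⟶ B), ι ≫ κ = φ ∧ (IsIsometry F ι ∧ IsPreStep F ι) ∧
      (IsCoAngular F κ ∧ IsLinear F κ) := by
  obtain ⟨X, p, q, hfac, hp, hq⟩ := (isLinear_iff_exists_preStep_pullback F hF φ).mp hφ
  obtain ⟨Y, i, c, hfac', hi, hc⟩ := hF.v_c_exists p hp
  obtain ⟨⟨hqco, _⟩, hqlin⟩ := hF.iv_b q hq
  refine ⟨Y, i, c ≫ q, ?_, hi, hF.iii_a c q hc.1 hqco, IsLinear.comp F hc.2.1 hqlin⟩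
  rw [← Category.assoc, hfac', hfac]

/-- **Prop. 1.7 (v)**, co-angular linear morphisms (the text's argument with
`α = α₁ ∘ α₂`, `β = β₁ ∘ β₂`, `α₂ ∘ β₁ = γ₁ ∘ γ₂`). [cite: MochizukiFrdI2008, Prop. 1.7] -/
theorem isCoAngular_isLinear_factors (hF : IsFrobenioid F) {X Y Z : C} {β : X ⟶ Y} {α : Y ⟶ Z}
    (hco : IsCoAngular F (β ≫ α)) (hlin : IsLinear F (β ≫ α)) :
    (IsCoAngular F α ∧ IsLinear F α) ∧ (IsCoAngular F β ∧ IsLinear F β) := by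
  have hC : IsTotallyEpimorphic C := hF.isPreFrobenioid.isTotallyEpimorphic
  obtain ⟨hαlin, hβlin⟩ := isLinear_factors F hlin
  obtain ⟨Xβ, β₂, β₁, hβfac, hβ₂, hβ₁⟩ := exists_isometricPreStep_coAngularLinear F hF β hβlin
  obtain ⟨Xα, α₂, α₁, hαfac, hα₂, hα₁⟩ := exists_isometricPreStep_coAngularLinear F hF α hαlin
  obtain ⟨Xγ, γ₂, γ₁, hγfac, hγ₂, hγ₁⟩ :=
    exists_isometricPreStep_coAngularLinear F hF (β₁ ≫ α₂) (IsLinear.comp F hβ₁.2 hα₂.2.1)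
  have key : β₂ ≫ (γ₂ ≫ γ₁) ≫ α₁ = β ≫ α := by
    rw [hγfac, ← hβfac, ← hαfac]
    simp only [Category.assoc]
  -- co-angularity of `φ = (α₁ ∘ γ₁) ∘ (γ₂ ∘ β₂)`
  haveI : IsIso (β₂ ≫ γ₂) :=
    hco (𝟙 X) (β₂ ≫ γ₂) (γ₁ ≫ α₁) (by rw [Category.id_comp, ← key]; simp only [Category.assoc])
      (IsLinear.comp F hγ₁.2 hα₁.2) (IsIsometry.comp F hβ₂.1 hγ₂.1) (IsPreStep.comp F hβ₂.2 hγ₂.2)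
      (Or.inr (isBaseIso_of_isIso F (𝟙 X)))
  haveI : IsIso γ₂ := (hC.isIso_of_isIso_comp β₂ γ₂).1
  haveI : IsIso β₂ := (hC.isIso_of_isIso_comp β₂ γ₂).2
  -- co-angularity of `α₂ ∘ β₁ = γ₁ ∘ γ₂`
  have hco' : IsCoAngular F (β₁ ≫ α₂) := by
    rw [← hγfac]
    exact hF.iii_a γ₂ γ₁ (isCoAngular_of_isIso F hC γ₂) hγ₁.1
  haveI : IsIso α₂ :=
    hco' β₁ α₂ (𝟙 Xα) (by rw [Category.comp_id]) (isLinear_of_isIso F (𝟙 Xα)) hα₂.1 hα₂.2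
      (Or.inl (isBaseIso_of_isIso F (𝟙 Xα)))
  refine ⟨⟨?_, hαlin⟩, ⟨?_, hβlin⟩⟩
  · rw [← hαfac]
    exact hF.iii_a α₂ α₁ (isCoAngular_of_isIso F hC α₂) hα₁.1
  · rw [← hβfac]
    exact hF.iii_a β₂ β₁ (isCoAngular_of_isIso F hC β₂) hβ₁.1

/-- **Prop. 1.7 (v)**, pull-back morphisms ("from assertion (v) for co-angular linear isometries
[cf. also Proposition 1.4, (ii)]"). [cite: MochizukiFrdI2008, Prop. 1.7] -/
theorem isPullbackMorphism_factors (hF : IsFrobenioid F) {X Y Z : C} {β : X ⟶ Y} {α : Y ⟶ Z}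
    (h : IsPullbackMorphism F (β ≫ α)) : IsPullbackMorphism F α ∧ IsPullbackMorphism F β := by
  obtain ⟨⟨hco, hiso⟩, hlin⟩ := hF.iv_b _ h
  obtain ⟨⟨hαco, hαlin⟩, ⟨hβco, hβlin⟩⟩ := isCoAngular_isLinear_factors F hF hco hlin
  obtain ⟨hαiso, hβiso⟩ := isIsometry_factors F hF.isPreFrobenioid hiso
  exact ⟨(isPullbackMorphism_iff_isLBInvertible_isLinear F hF α).mpr ⟨⟨hαco, hαiso⟩, hαlin⟩,
    (isPullbackMorphism_iff_isLBInvertible_isLinear F hF β).mpr ⟨⟨hβco, hβiso⟩, hβlin⟩⟩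

/-- **Prop. 1.7 (v)**, morphisms of Frobenius type with isotropic domain ("morphisms of `C^istr`
are always co-angular [cf. Proposition 1.4, (i)]", with Def. 1.3 (vii)(b)).
[cite: MochizukiFrdI2008, Prop. 1.7] -/
theorem isFrobeniusType_factors (hF : IsFrobenioid F) {X Y Z : C} {β : X ⟶ Y} {α : Y ⟶ Z}
    (h : IsFrobeniusType F (β ≫ α)) (hX : IsIsotropic F X) :
    IsFrobeniusType F α ∧ IsFrobeniusType F β := by
  obtain ⟨hαiso, hβiso⟩ := isIsometry_factors F hF.isPreFrobenioid h.1.2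
  obtain ⟨hαb, hβb⟩ := isBaseIso_factors F hF.isPreFrobenioid.isTotallyEpimorphic_base h.2
  have hY : IsIsotropic F Y := hF.vii_b β hX
  have hβco : IsCoAngular F β :=
    isCoAngular_of_isIsotropic_codomains F β (fun _ f => hF.vii_b f hX)
  have hαco : IsCoAngular F α :=
    isCoAngular_of_isIsotropic_codomains F α (fun _ f => hF.vii_b f hY)
  exact ⟨⟨⟨hαco, hαiso⟩, hαb⟩, ⟨⟨hβco, hβiso⟩, hβb⟩⟩

end PreFrobenioid

end Literature.AlgebraicGeometry.Frobenioids
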